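import Summits.BirchSwinnertonDyer.BirchSwinnertonDyer.Theorems.PrintCf2RubinValueTwoRowTwoTwistedKummerRoots
import Summits.BirchSwinnertonDyer.BirchSwinnertonDyer.Theorems.PrintCf2RubinValueTwoRowTwoTwistedKummerLaws
import Summits.BirchSwinnertonDyer.BirchSwinnertonDyer.Theorems.PrintCf2RubinValueTwoRowTwoTwistedKummerConj
import Summits.BirchSwinnertonDyer.BirchSwinnertonDyer.Theorems.PrintCf2RubinValueTwoRowTwoCosetNorm
import Mathlib.Tactic.Group
import HarnessLib

/-!
# F0b (zeta pins of `JohnsonLeungKings2011.TwistedIwasawaData`), FILE 1: the θ-SCALAR CONJUGATION LAW of the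
# twisted Kummer classes and the remaining class laws (inverse, powers, fixed elements, `p^k`-th powers agreeing
# up to a fixed element, coset products = norms)

Cell `bsd-print-cf2`, WIDTH seat `bsd-line-cf2-p1-w5` g10 (prover-bsd-line-cf2-p1-w5-g10-0); construction F0b of route C
(`PrintCf2RubinValueTwo`) = `Nonempty (JohnsonLeungKings2011.TwistedIwasawaData …)` (plan `HOME/bsd-line-cf2-p1-w5/F0B-ASSEMBLY-PLAN-w5g9.md`);
`--supports` the deciding child stmt-BirchSwinnertonDyer-24721 (helper, Theses-free). THEOREMS ONLY (no definition, no named fact, no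
instance, no `sorry`). HONEST FRAMING: cohomological bookkeeping on ty2's predicate `IsTwistedKummerClass`; nothing here closes the crux; no
summit statement is proved by this seat; BSD is not proved by any of this.

WHAT (all for ty2's `IsTwistedKummerClass p θ S U k β c`, -w6 g8's constructor/uniqueness and laws imported):
* §1 `isTwistedKummerClass_of_forall_smul_div_eq` (transfer along equal cocycle values), `isTwistedKummerClass_zero_of_forall_smul_eq`
  (a `U`-FIXED `η` has class `0`), `isTwistedKummerClass_inv` (`β⁻¹ ↦ −c`), `isTwistedKummerClass_pow` (`β^m ↦ m • c`),
  `isTwistedKummerClass_pow_mul_inv` (`β^m·β'⁻¹ ↦ m • c − c'`);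
* §2 **the θ-scalar conjugation law** `isTwistedKummerClass_levelConj_pow` — JLK §3.3 (5) "`g⋆(κ(u) ⊗ t) = η(g)·κ(gu) ⊗ t`": for ANY
  `γ ∈ Γ_K`, `levelConj … k 1 γ c` is a class of `(γ•β)^{m}`, `m = (θ(γ) mod p^k)` (generalises -w6 g8's `isTwistedKummerClass_levelConj`,
  the case `θ γ = 1`); `smul_smul_eq_of_mem_normal` (conjugates of `N_S`-fixed units are `N_S`-fixed); the scalar cancellation
  `zsmul_val_inv_mul_val_eq_self` (`(θ(γ)⁻¹ mod p^k)·(θ(γ) mod p^k)` acts as `1` on a `p^k`-torsion class);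
* §3 `eq_of_isTwistedKummerClass_of_pow_eq_pow_mul_pow` — two classes whose radicands `B^{p^k}`, `B'^{p^k}` differ by the `p^k`-th
  power of a `U`-fixed `η` COINCIDE (the form in which Kato's 12th-root ambiguity is absorbed, with -w5 g9's twelfth-root slack);
* §4 `prod_smul_eq_normOver_of_eq` — -w6 g8's `∏ₓ s(x)·u = N_{F'/F}(u)` transported to any subgroups EQUAL to `galFixing` (ty2's
  `katoLevelSubgroup` is `absGaloisFixingSubgroup`, equal but not definitionally); `finiteIndex_of_isOpen'` (open subgroups of a compact
  group have finite index).

References: J. Johnson-Leung, G. Kings, J. reine angew. Math. 653 (2011) §3.3 (5)–(6), Def. 3.5, Prop. 3.3; J.-P. Serre, *Local Fields* X §3 b),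
VII §5; J. Neukirch, A. Schmidt, K. Wingberg (2008) I §5.
-/

noncomputable section

open scoped Classical

-- the summit namespace `Summit.BirchSwinnertonDyer.BirchSwinnertonDyer` repeats the problem name by design (D-0017)
set_option linter.dupNamespace false
set_option autoImplicit false

open scoped NumberField
open Field IsDedekindDomain IntermediateField
open Literature.NumberTheory.GaloisRepresentations Literature.NumberTheory.GaloisRepresentations.DiscreteGaloisModule
open Literature.NumberTheory.GaloisRepresentations.LocalWeilDatum
open Literature.NumberTheory.ComplexMultiplication.EllipticUnits
open Literature.NumberTheory.ComplexMultiplication.EllipticUnits.JohnsonLeungKings2011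
open Literature.NumberTheory.EllipticCurves (subgroupConj subgroupConj_apply_coe)
open Summit.BirchSwinnertonDyer.BirchSwinnertonDyer.Theorems.PrintCf2.RowTwo

namespace Summit.BirchSwinnertonDyer.BirchSwinnertonDyer.Theorems.PrintCf2.TwistedZeta

variable {K : Type} [Field K] [NumberField K] (p : ℕ) [Fact p.Prime] (S : Set (HeightOneSpectrum (𝓞 K)))
  (θ : absoluteGaloisGroup K →ₜ* ℤ_[p]ˣ) (k : ℕ) (U : Subgroup (absoluteGaloisGroup K))

/-! ## §1. Transfer, fixed elements, inverses, powers -/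

omit [NumberField K] in
/-- **Transfer along equal cocycle values**: if `σβ'/β' = σβ/β` for all `σ ∈ U` then every class of `β` is a class of `β'` (the
predicate only reads the values `σβ/β`, `σ ∈ U`). [cite: JohnsonLeungKings2011, §3.3 (5)–(6) (arXiv p0010:L61–70)] -/
theorem isTwistedKummerClass_of_forall_smul_div_eq {β β' : (AlgebraicClosure K)ˣ}
    (h : ∀ σ ∈ U, σ • β' / β' = σ • β / β) {c : levelCoh p S θ U k 1} (hc : IsTwistedKummerClass p θ S U k β c) :
    IsTwistedKummerClass p θ S U k β' c := by
  obtain ⟨φ, hφ, hφv⟩ := hc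
  exact ⟨φ, hφ, fun σ hσ ↦ (hφv σ hσ).trans (h σ hσ).symm⟩

omit [NumberField K] in
/-- **A `U`-fixed unit has twisted Kummer class `0`** (its cocycle `σ ↦ ση/η` vanishes on `U`).
[cite: JohnsonLeungKings2011, §3.3 (5)–(6) (arXiv p0010:L61–70)] -/
theorem isTwistedKummerClass_zero_of_forall_smul_eq {η : (AlgebraicClosure K)ˣ} (hη : ∀ σ ∈ U, σ • η = η) :
    IsTwistedKummerClass p θ S U k η (0 : levelCoh p S θ U k 1) :=
  isTwistedKummerClass_of_forall_smul_div_eq p S θ k U (fun σ hσ ↦ by rw [hη σ hσ, smul_one, div_self', div_one])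
    (isTwistedKummerClass_zero_one p S θ U k)

omit [NumberField K] in
/-- **Inverse law**: a class `c` of `β` gives the class `−c` of `β⁻¹` (`σβ⁻¹/β⁻¹ = (σβ/β)⁻¹`).
[cite: JohnsonLeungKings2011, §3.3 (5)–(6) (arXiv p0010:L61–70)] -/
theorem isTwistedKummerClass_inv {β : (AlgebraicClosure K)ˣ} {c : levelCoh p S θ U k 1} (hc : IsTwistedKummerClass p θ S U k β c) :
    IsTwistedKummerClass p θ S U k β⁻¹ (-c) := by
  obtain ⟨φ, rfl, hφ⟩ := hc
  refine ⟨-φ, (map_neg (oneCocycleClassₗ (levelRep p S θ U k).toTopRep) φ), fun σ hσ ↦ ?_⟩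
  change muVal K (p ^ k) (((-φ.1) ⟨toUnramifiedQuot K S σ, Subgroup.mem_map_of_mem _ hσ⟩ :
      Representation.invariants ((muTwist p θ k).toRepresentation.comp (ramificationSubgroup K S).subtype)) :
        MuCarrier K (p ^ k)) = _
  rw [ContinuousMap.neg_apply, Submodule.coe_neg, ← zero_sub, muVal_sub, muVal_zero, hφ σ hσ, smul_inv', inv_div_inv,
      one_div_div]

omit [NumberField K] in
/-- **Power law**: a class `c` of `β` gives the class `m • c` of `β^m`. [cite: JohnsonLeungKings2011, §3.3 (5)–(6) (arXiv p0010:L61–70)] -/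
theorem isTwistedKummerClass_pow {β : (AlgebraicClosure K)ˣ} {c : levelCoh p S θ U k 1} (hc : IsTwistedKummerClass p θ S U k β c)
    (m : ℕ) : IsTwistedKummerClass p θ S U k (β ^ m) (m • c) := by
  induction m with
  | zero => rw [pow_zero, zero_smul]; exact isTwistedKummerClass_zero_one p S θ U k
  | succ m ih => rw [pow_succ, succ_nsmul]; exact isTwistedKummerClass_mul p S θ U k ih hc

omit [NumberField K] in
/-- **`β^m · β'⁻¹ ↦ m • c − c'`** (power, inverse and product laws combined; the shape of the (Z2) radicands
`β_𝔞^{N𝔟}(σ_𝔟β_𝔞)⁻¹`). [cite: JohnsonLeungKings2011, §3.3 (5)–(6) and Prop. 3.3 (3) (arXiv p0009:L88–95, p0010:L61–70)] -/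
theorem isTwistedKummerClass_pow_mul_inv {β β' : (AlgebraicClosure K)ˣ} {c c' : levelCoh p S θ U k 1}
    (hc : IsTwistedKummerClass p θ S U k β c) (hc' : IsTwistedKummerClass p θ S U k β' c') (m : ℕ) :
    IsTwistedKummerClass p θ S U k (β ^ m * β'⁻¹) ((m : ℤ) • c - c') := by
  rw [sub_eq_add_neg, natCast_zsmul]
  exact isTwistedKummerClass_mul p S θ U k (isTwistedKummerClass_pow p S θ k U hc m) (isTwistedKummerClass_inv p S θ k U hc')

/-! ## §2. The θ-scalar conjugation law (JLK §3.3 (5)) -/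

omit [NumberField K] in
/-- **THE θ-SCALAR CONJUGATION LAW** ("`g⋆(κ(u) ⊗ t_p(η)) = η(g)·(κ(gu) ⊗ t_p(η))`", §3.3 (5)): for `U ⊴ Γ_K`, ANY `γ ∈ Γ_K` and a twisted
Kummer class `c` of `β` at level `U`, the conjugate `levelConj … k 1 γ c` is a twisted Kummer class of `(γ•β)^m` with
`m = (θ(γ) mod p^k)` read in `ℕ` — on cochains `(γ·φ)(σ) = γ ⋆_θ φ(γ⁻¹σγ) = (γ((γ⁻¹σγ)β/β))^{θ(γ)} = σ((γβ)^m)/(γβ)^m`. For `θ γ = 1` this is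
-w6 g8's `isTwistedKummerClass_levelConj`. [cite: JohnsonLeungKings2011, §3.3 (5) (arXiv p0010:L61–70) and §4.2 (p0012:L109–112)] [cite: SerreLocalFields1979, VII §5] -/
theorem isTwistedKummerClass_levelConj_pow [U.Normal] {β : (AlgebraicClosure K)ˣ} {c : levelCoh p S θ U k 1}
    (hc : IsTwistedKummerClass p θ S U k β c) (γ : absoluteGaloisGroup K) :
    IsTwistedKummerClass p θ S U k ((γ • β) ^ (PadicInt.toZModPow k ((θ γ : ℤ_[p]ˣ) : ℤ_[p])).val)
      (levelConj p S θ U k 1 γ c) := by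
  haveI hN : (imGS S U).Normal := Subgroup.Normal.map inferInstance _ (toUnramifiedQuot_surjective K S)
  obtain ⟨φ₀, rfl, hφ⟩ := hc
  let X := (coeffGS p S θ k).toTopRep
  let g : GaloisGroupUnramifiedOutside K S := toUnramifiedQuot K S γ
  let φ : contOneCocycles (subgroupRep X (imGS S U)) := φ₀
  let ψ : contOneCocycles (subgroupRep X (imGS S U)) :=
    contOneCocycles.pullback (subgroupConj (imGS S U) g) (conjRepHom X (imGS S U) g) φ
  refine ⟨ψ, ?_, fun σ hσ ↦ ?_⟩
  · rw [levelConj_apply]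
    exact (conjMap_oneCocycleClass X (imGS S U) g φ).symm
  · have hσ' : γ⁻¹ * σ * γ ∈ U := by
      have h := Subgroup.Normal.conj_mem inferInstance σ hσ γ⁻¹
      rwa [inv_inv] at h
    have hx : subgroupConj (imGS S U) g ⟨toUnramifiedQuot K S σ, Subgroup.mem_map_of_mem _ hσ⟩ =
        (⟨toUnramifiedQuot K S (γ⁻¹ * σ * γ), Subgroup.mem_map_of_mem _ hσ'⟩ : imGS S U) := by
      apply Subtype.ext
      change g⁻¹ * toUnramifiedQuot K S σ * g = toUnramifiedQuot K S (γ⁻¹ * σ * γ)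
      rw [map_mul, map_mul, map_inv]
    change muVal K (p ^ k) (muTwist p θ k γ
      ((φ.1 (subgroupConj (imGS S U) g ⟨toUnramifiedQuot K S σ, Subgroup.mem_map_of_mem _ hσ⟩) :
          Representation.invariants ((muTwist p θ k).toRepresentation.comp (ramificationSubgroup K S).subtype)) :
        MuCarrier K (p ^ k))) = _
    rw [hx, muVal_muTwist_apply, charModPow_apply, muVal_apply, hφ _ hσ', smul_div', ← mul_smul,
      show γ * (γ⁻¹ * σ * γ) = σ * γ by group, mul_smul, div_pow, ← smul_pow']

omit [NumberField K] in
/-- Conjugates of units fixed by a NORMAL subgroup are fixed by it (`τ(σβ) = σ((σ⁻¹τσ)β)`); used with `N_S ⊴ Γ_K`.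
[cite: SerreLocalFields1979, VII §5] -/
theorem smul_smul_eq_of_mem_normal (N : Subgroup (absoluteGaloisGroup K)) [N.Normal] {β : (AlgebraicClosure K)ˣ}
    (hβ : ∀ τ ∈ N, τ • β = β) (σ : absoluteGaloisGroup K) : ∀ τ ∈ N, τ • (σ • β) = σ • β := by
  intro τ hτ
  have hτ' : σ⁻¹ * τ * σ ∈ N := by
    have h := Subgroup.Normal.conj_mem inferInstance τ hτ σ⁻¹
    rwa [inv_inv] at h
  rw [← mul_smul, show τ * σ = σ * (σ⁻¹ * τ * σ) by group, mul_smul, hβ _ hτ']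

omit [NumberField K] in
/-- **Scalar cancellation**: `(x⁻¹ mod p^k)·(x mod p^k)` (read in `ℕ`) acts as `1` on every element killed by `p^k` — the constant
`χ(σ_𝔞)⁻¹` of ty2's `nsubElt` against the scalar `θ(σ_𝔞)` of the conjugation law. [cite: JohnsonLeungKings2011, §5.1 (arXiv p0014:L18–26), §3.3 (5)] -/
theorem zsmul_val_inv_mul_val_eq_self {M : Type*} [AddCommGroup M] {x : M} (hx : p ^ k • x = 0) (y : ℤ_[p]ˣ) :
    (((PadicInt.toZModPow k ((y⁻¹ : ℤ_[p]ˣ) : ℤ_[p])).val : ℤ) * ((PadicInt.toZModPow k ((y : ℤ_[p]ˣ) : ℤ_[p])).val : ℤ)) • x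
      = x := by
  haveI : NeZero (p ^ k) := ⟨pow_ne_zero _ (Fact.out : p.Prime).ne_zero⟩
  set a : ℕ := (PadicInt.toZModPow k ((y⁻¹ : ℤ_[p]ˣ) : ℤ_[p])).val * (PadicInt.toZModPow k ((y : ℤ_[p]ˣ) : ℤ_[p])).val
    with ha
  have hamod : a % p ^ k = 1 % p ^ k := by
    have h1 : ((a : ℕ) : ZMod (p ^ k)) = ((1 : ℕ) : ZMod (p ^ k)) := by
      rw [ha, Nat.cast_mul, ZMod.natCast_zmod_val, ZMod.natCast_zmod_val, ← map_mul, Units.inv_mul, map_one, Nat.cast_one]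
    exact (ZMod.natCast_eq_natCast_iff' _ _ _).mp h1
  have hsmul : ∀ b : ℕ, (b : ℤ) • x = ((b % p ^ k : ℕ) : ℤ) • x := fun b ↦ by
    conv_lhs => rw [← Nat.mod_add_div b (p ^ k)]
    rw [natCast_zsmul, natCast_zsmul, add_nsmul, mul_nsmul, hx, nsmul_zero, add_zero]
  rw [← Nat.cast_mul, ← ha, hsmul a, hamod, ← hsmul 1, Nat.cast_one, one_zsmul]

/-! ## §3. Radicands agreeing up to the `p^k`-th power of a fixed element -/

omit [NumberField K] in
/-- **Two classes whose radicands satisfy `B^{p^k} = η^{p^k}·B'^{p^k}` with `η` fixed by `U` coincide** (`θ|_U = 1`, `θ|_{N_S} = 1`, `N_S`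
fixing `μ_{p^k}`): `ηB'` has the class `0 + c'` and the same `p^k`-th power as `B`, so -w6 g9's root independence + -w6 g8's uniqueness
apply. This is how Kato's 12th-root-of-unity ambiguity of the representatives `_𝔞θ_E(α)` disappears from the pins (Z1)/(Z2): by -w5 g9's
`exists_pow_eq_of_pow_twelve_eq_one` a 12th root of unity of `K(p^s𝔣)` is `η^{p^k}`, `η ∈ K(p^s𝔣)`, once `s ≥ k + 2`.
[cite: JohnsonLeungKings2011, Prop. 3.3 (1) and its proof, Def. 3.5 (arXiv p0009:L85–127, p0010:L72–80)] [cite: Kato2004Asterisque, §15.5 (p. 253)] -/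
theorem eq_of_isTwistedKummerClass_of_pow_eq_pow_mul_pow (hθU : ∀ σ ∈ U, θ σ = 1)
    (hθN : ∀ τ ∈ ramificationSubgroup K S, θ τ = 1)
    (hμN : ∀ τ ∈ ramificationSubgroup K S, ∀ ζ : (AlgebraicClosure K)ˣ, ζ ^ (p ^ k) = 1 → τ • ζ = ζ)
    {η B B' : (AlgebraicClosure K)ˣ} (hη : ∀ σ ∈ U, σ • η = η) (h : B ^ (p ^ k) = η ^ (p ^ k) * B' ^ (p ^ k))
    {c c' : levelCoh p S θ U k 1} (hc : IsTwistedKummerClass p θ S U k B c) (hc' : IsTwistedKummerClass p θ S U k B' c') : c = c' := by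
  have h1 : IsTwistedKummerClass p θ S U k (η * B') c' := by
    simpa only [zero_add] using isTwistedKummerClass_mul p S θ U k (isTwistedKummerClass_zero_of_forall_smul_eq p S θ k U hη) hc'
  exact eq_of_isTwistedKummerClass_of_pow_eq p S θ k U hθU hθN hμN (β := B) (β' := η * B') (by rw [mul_pow, h]) hc h1

/-! ## §4. Coset products over subgroups equal to `galFixing`; finite index of open subgroups -/

omit [NumberField K] in
/-- **`∏_{x ∈ U/U'} s(x)·u = N_{F'/F}(u)`** for ANY subgroups `U = Gal(K̄/F)`, `U' = Gal(K̄/F')` given as EQUAL to the tree's `galFixing` (e.g. ty2's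
`katoLevelSubgroup = absGaloisFixingSubgroup`, `galFixing_eq_absGaloisFixingSubgroup`) and any system of representatives — -w6 g8's
`RowTwo.prod_smul_eq_normOver` transported. [cite: NeukirchANT1999, Ch. IV §1] [cite: JohnsonLeungKings2011, Def. 3.5 (arXiv p0010:L72–80)] -/
theorem prod_smul_eq_normOver_of_eq {F F' : IntermediateField K (AlgebraicClosure K)} (h : F ≤ F') [FiniteDimensional K F'] [IsGalois K F']
    {V V' : Subgroup (absoluteGaloisGroup K)} (hV : V = galFixing K F) (hV' : V' = galFixing K F') [Fintype (V ⧸ V'.subgroupOf V)]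
    {s : V ⧸ V'.subgroupOf V → V} (hs : ∀ x, (s x : V ⧸ V'.subgroupOf V) = x) (u : F') :
    ∏ x, ((s x : V) : absoluteGaloisGroup K) • (u : AlgebraicClosure K) = ((normOver F' F u : F') : AlgebraicClosure K) := by
  subst hV hV'
  exact prod_smul_eq_normOver h hs u

/-- An open subgroup of the (compact) absolute Galois group has finite index. [cite: NeukirchSchmidtWingberg2008, (1.2.5)] -/
theorem finiteIndex_of_isOpen' {V : Subgroup (absoluteGaloisGroup K)} (hV : IsOpen (V : Set (absoluteGaloisGroup K))) : V.FiniteIndex := by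
  haveI : DiscreteTopology (absoluteGaloisGroup K ⧸ V) := QuotientGroup.discreteTopology hV
  haveI : Finite (absoluteGaloisGroup K ⧸ V) := finite_of_compact_of_discrete
  exact Subgroup.finiteIndex_of_finite_quotient

end Summit.BirchSwinnertonDyer.BirchSwinnertonDyer.Theorems.PrintCf2.TwistedZeta

end
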